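import Literature.Analysis.TotalPositivity.PolyaFrequencyFunctions
import Literature.Analysis.TotalPositivity.FeketeCriterion
import Mathlib.LinearAlgebra.Vandermonde
import Mathlib.Analysis.SpecialFunctions.Gaussian.FourierTransform
import Mathlib.Topology.Instances.Matrix
import HarnessLib

/-!
# Pólya frequency functions: the normal frequency function (Schoenberg 1951, example 1)

Trunk `Literature/Analysis/TotalPositivity`, third proofs file accompanying
`PolyaFrequencyFunctions.lean` (the named fact `schoenberg1951_pf_laplace`), continuing the
bottom-up formalisation of the sufficiency half of Schoenberg's theorem: **the Gaussian
`e^{−ax²}` (`a > 0`) is a Pólya frequency function** [SchoenbergWhitney1953, Introduction,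
example 1, eq. (3)], with reciprocal Laplace transform `(π/a)^{−1/2} e^{−s²/(4a)}` on every strip
— the factor `e^{−γs²}` of Schoenberg's product (7) (`a = 1/(4γ)`).

The total positivity of the Gauss kernel `e^{−a(x−y)²} = e^{−ax²} e^{2axy} e^{−ay²}` reduces to
that of the kernel `e^{xy}`, i.e. to `det ‖e^{x_i y_j}‖ ≥ 0` for increasing reals `x, y`
[Karlin1968, Ch. 3, §1 (c)]. We prove the latter by rational approximation of the `y_j`
(`y_j ← (⌊q y_j⌋ + j)/q`, still increasing): for integer exponents `m_j` the determinant
`det ‖(e^{x_i/q})^{m_j}‖` is a generalised Vandermonde determinant with increasing natural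
exponents (after clearing a common power) in the increasing positive nodes `t_i = e^{x_i/q}`,
which is `> 0` by Fekete's criterion (`det_submatrix_pos_of_contiguous`, FeketeCriterion.lean:
contiguous minors of `(t_i^m)_{i,m}` are powers times ordinary Vandermonde determinants), and
determinants are continuous.

## Main results

* `det_pow_pos` — generalised Vandermonde determinants with natural exponents are positive.
* `det_exp_mul_nonneg` — `det ‖e^{x_i y_j}‖ ≥ 0` for increasing real nodes.
* `isPolyaFrequencyFun_gaussian` — `c e^{−ax²}` (`a, c > 0`) is a Pólya frequency function.
* `hasLaplaceTransformInvOn_gaussian` — its Laplace transform (Mathlib's Gaussian integral).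

## References

* I. J. Schoenberg, *On Pólya frequency functions. I*, J. Analyse Math. 1 (1951) 331–374, §1
  example 1. [Schoenberg1951]
* I. J. Schoenberg, A. Whitney, *On Pólya frequency functions. III*, Trans. AMS 74 (1953),
  Introduction, eq. (3). [SchoenbergWhitney1953]
* S. Karlin, *Total Positivity* I (1968), Ch. 3 §1 (the kernels `e^{xy}`, `e^{−(x−y)²}`),
  Ch. 2 §2 (generalised Vandermonde). [Karlin1968]
* S. M. Fallat, C. R. Johnson, *Totally Nonnegative Matrices* (2011), Cor. 3.1.5 (Fekete).
  [FallatJohnson2011]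
-/

noncomputable section

open MeasureTheory Set Filter
open scoped Topology

namespace Literature.Analysis.TotalPositivity

/-! ### Generalised Vandermonde determinants -/

/-- **Generalised Vandermonde determinants are positive**: for `0 < t₀ < t₁ < ⋯` and natural
exponents `e₀ < e₁ < ⋯`, `det ‖t_i^{e_j}‖ > 0`.  Fekete's criterion applied to the matrix
`(t_i^m)_{i<n, m<N}`, whose contiguous minors are `∏ t^{m₀} ×` (Vandermonde) `> 0`.
[cite: Karlin1968, Ch. 2 §2] [cite: FallatJohnson2011, Cor. 3.1.5] -/
theorem det_pow_pos {n : ℕ} {t : Fin n → ℝ} (ht : StrictMono t) (ht0 : ∀ i, 0 < t i)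
    {e : Fin n → ℕ} (he : StrictMono e) :
    0 < (Matrix.of fun i j : Fin n => t i ^ e j).det := by
  rcases Nat.eq_zero_or_pos n with rfl | hn
  · simp
  set N : ℕ := e ⟨n - 1, by omega⟩ + 1 with hN
  have heN : ∀ j : Fin n, e j < N := fun j => by
    have hj : j ≤ (⟨n - 1, by omega⟩ : Fin n) := by
      rw [Fin.le_def]
      have := j.2
      show (j : ℕ) ≤ n - 1
      omega
    have : e j ≤ e ⟨n - 1, by omega⟩ := he.monotone hj
    omega
  set A : Matrix (Fin n) (Fin N) ℝ := Matrix.of fun i m => t i ^ (m : ℕ) with hA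
  set c : Fin n → Fin N := fun j => ⟨e j, heN j⟩ with hc
  have hcm : StrictMono c := fun i j hij => Fin.mk_lt_mk.2 (he hij)
  have hcontig : ∀ k, k ≤ n → ∀ (i₀ j₀ : ℕ) (hi : i₀ + k ≤ n) (hj : j₀ + k ≤ N),
      0 < (A.submatrix (fun i : Fin k => (⟨i₀ + i, by omega⟩ : Fin n))
        (fun j : Fin k => (⟨j₀ + j, by omega⟩ : Fin N))).det := by
    intro k _ i₀ j₀ hi hj
    have hfac : A.submatrix (fun i : Fin k => (⟨i₀ + i, by omega⟩ : Fin n))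
        (fun j : Fin k => (⟨j₀ + j, by omega⟩ : Fin N)) =
        Matrix.of fun a b : Fin k => t ⟨i₀ + a, by omega⟩ ^ j₀ *
          Matrix.vandermonde (fun a : Fin k => t ⟨i₀ + a, by omega⟩) a b := by
      ext a b
      simp [hA, Matrix.vandermonde_apply, pow_add]
    rw [hfac, Matrix.det_mul_column, Matrix.det_vandermonde]
    refine mul_pos (Finset.prod_pos fun a _ => pow_pos (ht0 _) _) ?_
    refine Finset.prod_pos fun a _ => Finset.prod_pos fun b hb => ?_
    rw [Finset.mem_Ioi] at hb
    refine sub_pos.2 (ht (Fin.mk_lt_mk.2 ?_))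
    have := Fin.lt_def.1 hb
    omega
  have hmain := det_submatrix_pos_of_contiguous A (m := n) hcontig le_rfl id c strictMono_id hcm
  have hsub : A.submatrix id c = Matrix.of fun i j : Fin n => t i ^ e j := by
    ext i j
    simp [hA, hc]
  rwa [hsub] at hmain

/-! ### Total positivity of the kernel `e^{xy}` -/

/-- Integer exponents: `det ‖e^{x_i m_j / q}‖ > 0` for increasing reals `x`, increasing integers
`m` and `q > 0` — a generalised Vandermonde determinant in `t_i = e^{x_i/q}` after clearing the
common factor `e^{x_i m₀/q}` from the rows. [cite: Karlin1968, Ch. 3 §1] [folklore] -/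
theorem det_exp_mul_pos_of_int {n : ℕ} {x : Fin n → ℝ} (hx : StrictMono x) {m : Fin n → ℤ}
    (hm : StrictMono m) {q : ℝ} (hq : 0 < q) :
    0 < (Matrix.of fun i j : Fin n => Real.exp (x i * m j / q)).det := by
  rcases Nat.eq_zero_or_pos n with rfl | hn
  · simp
  set M : ℤ := m ⟨0, hn⟩ with hM
  have hmM : ∀ j, 0 ≤ m j - M := fun j => by
    have hj : (⟨0, hn⟩ : Fin n) ≤ j := by
      rw [Fin.le_def]
      exact Nat.zero_le _
    exact sub_nonneg.2 (hm.monotone hj)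
  set e : Fin n → ℕ := fun j => (m j - M).toNat with he
  have hemono : StrictMono e := fun i j hij => by
    have h1 := hm hij
    have h2 := hmM i
    simp only [he]
    omega
  have hecast : ∀ j, ((e j : ℕ) : ℝ) = (m j : ℝ) - M := fun j => by
    have h1 : ((e j : ℕ) : ℤ) = m j - M := Int.toNat_of_nonneg (hmM j)
    exact_mod_cast h1
  set t : Fin n → ℝ := fun i => Real.exp (x i / q) with ht
  have htmono : StrictMono t := fun i j hij =>
    Real.exp_lt_exp.2 (div_lt_div_of_pos_right (hx hij) hq)
  have ht0 : ∀ i, 0 < t i := fun i => Real.exp_pos _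
  have hfac : (Matrix.of fun i j : Fin n => Real.exp (x i * m j / q)) =
      Matrix.of fun i j : Fin n => Real.exp (x i * M / q) *
        (Matrix.of fun i j : Fin n => t i ^ e j) i j := by
    ext i j
    simp only [Matrix.of_apply, ht]
    rw [← Real.exp_nat_mul, ← Real.exp_add, hecast]
    congr 1
    field_simp
    ring
  rw [hfac, Matrix.det_mul_column]
  exact mul_pos (Finset.prod_pos fun i _ => Real.exp_pos _) (det_pow_pos htmono ht0 hemono)

/-- **The kernel `e^{xy}` is totally positive**: `det ‖e^{x_i y_j}‖ ≥ 0` for increasing reals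
`x, y` (in fact `> 0`).  Approximate `y_j` by the increasing rationals `(⌊q y_j⌋ + j)/q` and pass
to the limit in the positive determinants of `det_exp_mul_pos_of_int`.
[cite: Karlin1968, Ch. 3 §1 (c)] [folklore] -/
theorem det_exp_mul_nonneg {n : ℕ} {x y : Fin n → ℝ} (hx : StrictMono x) (hy : StrictMono y) :
    0 ≤ (Matrix.of fun i j : Fin n => Real.exp (x i * y j)).det := by
  set m : ℕ → Fin n → ℤ := fun q j => ⌊(q : ℝ) * y j⌋ + j with hmdef
  have hm : ∀ q, StrictMono (m q) := by
    intro q i j hij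
    simp only [hmdef]
    have h1 : ⌊(q : ℝ) * y i⌋ ≤ ⌊(q : ℝ) * y j⌋ :=
      Int.floor_le_floor (mul_le_mul_of_nonneg_left (hy hij).le (Nat.cast_nonneg q))
    have h2 : ((i : ℕ) : ℤ) < ((j : ℕ) : ℤ) := by exact_mod_cast hij
    linarith
  have hlim : ∀ j, Tendsto (fun q : ℕ => (m q j : ℝ) / q) atTop (𝓝 (y j)) := by
    intro j
    rw [tendsto_iff_norm_sub_tendsto_zero]
    have hb : Tendsto (fun q : ℕ => ((j : ℝ) + 1) / q) atTop (𝓝 0) :=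
      tendsto_const_div_atTop_nhds_zero_nat _
    refine squeeze_zero' (Eventually.of_forall fun q => norm_nonneg _) ?_ hb
    filter_upwards [eventually_gt_atTop 0] with q hq
    have hq' : (0 : ℝ) < q := Nat.cast_pos.2 hq
    have h1 := Int.floor_le ((q : ℝ) * y j)
    have h2 := Int.lt_floor_add_one ((q : ℝ) * y j)
    have hj0 : (0 : ℝ) ≤ (j : ℕ) := Nat.cast_nonneg _
    have hkey : (m q j : ℝ) / q - y j = ((⌊(q : ℝ) * y j⌋ : ℝ) + (j : ℕ) - q * y j) / q := by
      simp only [hmdef, Int.cast_add, Int.cast_natCast]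
      field_simp
    rw [Real.norm_eq_abs, hkey, abs_div, abs_of_pos hq']
    refine div_le_div_of_nonneg_right ?_ hq'.le
    rw [abs_le]
    constructor <;> linarith
  have hdet : Tendsto (fun q : ℕ => (Matrix.of fun i j : Fin n =>
      Real.exp (x i * m q j / q)).det) atTop
      (𝓝 ((Matrix.of fun i j : Fin n => Real.exp (x i * y j)).det)) := by
    have hmat : Tendsto (fun q : ℕ => (Matrix.of fun i j : Fin n => Real.exp (x i * m q j / q)))
        atTop (𝓝 (Matrix.of fun i j : Fin n => Real.exp (x i * y j))) := by
      refine tendsto_pi_nhds.2 fun i => tendsto_pi_nhds.2 fun j => ?_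
      simp only [Matrix.of_apply]
      have h := (Real.continuous_exp.tendsto _).comp ((hlim j).const_mul (x i))
      refine h.congr fun q => ?_
      simp only [Function.comp_apply, mul_div_assoc]
    exact ((continuous_id.matrix_det).tendsto _).comp hmat
  refine ge_of_tendsto hdet ?_
  filter_upwards [eventually_gt_atTop 0] with q hq
  exact (det_exp_mul_pos_of_int hx (hm q) (Nat.cast_pos.2 hq)).le

/-! ### The Gaussian is a Pólya frequency function -/

/-- **The normal frequency function is a Pólya frequency function** (Schoenberg's example 1):
`c e^{−ax²}`, `a, c > 0`.  Its translation determinants factor as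
`det ‖c e^{−a(x_i−y_j)²}‖ = cⁿ (∏ e^{−ax_i²}) (∏ e^{−ay_j²}) det ‖e^{x_i · 2a y_j}‖ ≥ 0`.
[cite: SchoenbergWhitney1953, Introduction, example 1, eq. (3)]
[cite: Schoenberg1951, §1 (examples)] [cite: Karlin1968, Ch. 3 §1] -/
theorem isPolyaFrequencyFun_gaussian {a c : ℝ} (ha : 0 < a) (hc : 0 < c) :
    IsPolyaFrequencyFun fun u => c * Real.exp (-a * u ^ 2) := by
  refine ⟨fun u => mul_nonneg hc.le (Real.exp_pos _).le, ?_, ?_, ?_, ?_⟩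
  · exact (measurable_const.mul (Real.continuous_exp.measurable.comp
      (measurable_const.mul (measurable_id.pow_const 2))))
  · exact (integrable_exp_neg_mul_sq ha).const_mul c
  · rw [integral_const_mul, integral_gaussian]
    exact mul_pos hc (Real.sqrt_pos.2 (div_pos Real.pi_pos ha))
  · intro n x y hx hy
    unfold translationMinor
    have hfac : (Matrix.of fun i j : Fin n => c * Real.exp (-a * (x i - y j) ^ 2)) =
        c • Matrix.of fun i j : Fin n => Real.exp (-a * x i ^ 2) *
          (Matrix.of fun i j : Fin n => Real.exp (-a * y j ^ 2) *
            (Matrix.of fun i j : Fin n => Real.exp (x i * (2 * a * y j))) i j) i j := by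
      ext i j
      simp only [Matrix.smul_apply, Matrix.of_apply, smul_eq_mul]
      rw [← Real.exp_add, ← Real.exp_add]
      congr 2
      ring
    rw [hfac, Matrix.det_smul, Matrix.det_mul_column, Matrix.det_mul_row, Fintype.card_fin]
    refine mul_nonneg (pow_nonneg hc.le _) (mul_nonneg (Finset.prod_nonneg fun i _ =>
      (Real.exp_pos _).le) (mul_nonneg (Finset.prod_nonneg fun i _ => (Real.exp_pos _).le) ?_))
    exact det_exp_mul_nonneg hx fun i j hij => by nlinarith [hy hij]

/-- **Laplace transform of the Gaussian** (Schoenberg–Whitney (3)): for `a > 0`,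
`∫ e^{−xs} e^{−ax²} dx = √(π/a) e^{s²/(4a)}` for every `s ∈ ℂ` (absolutely convergent), i.e.
reciprocal transform `√(π/a)⁻¹ e^{−s²/(4a)}` on every strip; with `a = 1/(4γ)` this is the factor
`e^{−γs²}` of (7).  Mathlib's `integral_cexp_quadratic`.
[cite: SchoenbergWhitney1953, Introduction, eq. (3)] -/
theorem hasLaplaceTransformInvOn_gaussian {a : ℝ} (ha : 0 < a) (a' b' : ℝ) :
    HasLaplaceTransformInvOn (fun u => Real.exp (-a * u ^ 2))
      (fun s => ((Real.sqrt (Real.pi / a))⁻¹ : ℝ) * Complex.exp (-(s ^ 2 / (4 * a)))) a' b' := by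
  intro s _ _
  have hb : (-(a : ℂ)).re < 0 := by simpa using ha
  have hfun : (fun x : ℝ => Complex.exp (-(x : ℂ) * s) * ((Real.exp (-a * x ^ 2) : ℝ) : ℂ)) =
      fun x : ℝ => Complex.exp (-(a : ℂ) * x ^ 2 + (-s) * x + 0) := by
    funext x
    rw [Complex.ofReal_exp, ← Complex.exp_add]
    congr 1
    push_cast
    ring
  have hsqrt : ((Real.pi : ℂ) / -(-(a : ℂ))) ^ (1 / 2 : ℂ) = ((Real.sqrt (Real.pi / a) : ℝ) : ℂ) := by
    rw [neg_neg, Real.sqrt_eq_rpow, Complex.ofReal_cpow (by positivity : (0 : ℝ) ≤ Real.pi / a)]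
    push_cast
    norm_num
  have hpos : 0 < Real.sqrt (Real.pi / a) := Real.sqrt_pos.2 (div_pos Real.pi_pos ha)
  have hne : ((Real.sqrt (Real.pi / a) : ℝ) : ℂ) ≠ 0 := Complex.ofReal_ne_zero.2 hpos.ne'
  refine ⟨?_, ?_, ?_⟩
  · rw [hfun]
    exact integrable_cexp_quadratic' hb (-s) 0
  · exact mul_ne_zero (by exact_mod_cast (inv_ne_zero hpos.ne')) (Complex.exp_ne_zero _)
  · rw [hfun, integral_cexp_quadratic hb (-s) 0, hsqrt]
    beta_reduce
    simp only [mul_neg, div_neg, sub_neg_eq_add, zero_add, neg_sq]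
    rw [Complex.exp_neg]
    push_cast
    field_simp [Complex.exp_ne_zero]

end Literature.Analysis.TotalPositivity

end
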